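import Mathlib

/-!
HONEST FRAMING: exact (Metropolis-corrected) sampling algorithms for lattice gauge theory; figures of
merit are autocorrelation/cost numbers at stated couplings and volumes; no continuum-physics claim.

# Casimir grading — the abstract (Mathlib-only) core of the Peter–Weyl-free route to THEOREM A

THEORY-1 §19 (GEN-10).  THEOREM A of the venture (`LuscherGeometricGradientBound d n`, `Truncation.lean` §6;
equivalently `HasLocalModeNorm d n B₀`, `LocalModeNorm.lean`) asks for a volume-uniform geometric bound on the
link gradients of Lüscher's series `S̃^{(k)}`; THEOREM T (`MassTransferContraction.lean`, `LocalModeNorm.lean`)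
reduces it to the existence of *local mode norm data*.  §19 constructs such data WITHOUT harmonic analysis on
`SU(n)`: every term of `S̃^{(k)}` is a matrix coefficient `U ↦ ⟪ρ(U) v, w⟫` of an explicit tensor-power ("slot")
representation, with `w` in a joint eigenspace of the per-link Casimirs `C_e = ∑ₐ (X^a_e)† X^a_e`; the mass of
a term is `‖v‖ ‖w‖`, the weight of a link is `√c_e`.  This file is the representation-independent linear
algebra that closes the bookkeeping with `k`-independent constants: §1 `casimir X = ∑ₐ (X a)† (X a)`,
`⟪v, C v⟫ = ∑ₐ ‖X a v‖²`, the DERIVATIVE COST `‖X a w‖ ≤ √c ‖w‖` on a `c`-eigenvector, `c ≥ 0`; §2 the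
abstract TENSOR SHIFT: if `X' a = Y a + Z a`, `[Y a, Z a] = 0`, `Z a` skew-adjoint, then on a `c`-eigenvector
of `casimir Z` every eigenvalue `c'` of `casimir X'` has `|c' - c| ≤ ‖casimir Y‖ + 2 (∑ₐ ‖Y a‖) √c`
(Lüscher's "adding one box", with no Young diagrams); §3 the two-sided WEIGHT SHIFT `|√c' - √c| ≤ σ`,
`σ = τ + √(τ² + c̄)`; §4 GRADINGS (finite resolutions of the identity by pairwise-orthogonal self-adjoint
idempotents): Pythagoras, the RE-GRADING INEQUALITY `∑ᵢ ‖Pᵢ v‖ ‖Pᵢ w‖ ≤ ‖v‖ ‖w‖` (no mode count) and the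
splitting `⟪R v, w⟫ = ∑ᵢ ⟪R (Pᵢ v), Pᵢ w⟫` for `R` commuting with the grading; §5 the MATRIX-COEFFICIENT
BOUND `‖⟪R v, X a w⟫‖ ≤ ‖v‖ · √c · ‖w‖` for `‖R‖ ≤ 1`, and zero modes.  Elementary Hilbert-space algebra over
Mathlib (no `sorry`, no new axioms); the slot representations of `SU(n)^E`, the gap `c ≥ n/4` (from the
tree's `SUNBakryEmery.poincare_haar`) and the `LocalModeNormData` instance are the companion files of
THEORY-1 §19.5.  References: M. Lüscher, Commun. Math. Phys. 293 (2010) 899 [arXiv:0907.5491], §4, App. E;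
THEORY-1 §12 (paper proof of THEOREM A), §17 (THEOREM T), §19 (this route).  Tags: [ours] = venture
bookkeeping, [folklore] = standard linear algebra.
-/

open scoped InnerProductSpace ComplexConjugate
open ContinuousLinearMap Finset RCLike

namespace Summit.Ventures.LatticeQCDFlow.TrivializingMaps.CasimirGrading

variable {H : Type*} [NormedAddCommGroup H] [InnerProductSpace ℂ H]

/-! ## §1. The Casimir operator of a finite family -/
section Casimir
variable [CompleteSpace H] {ι : Type*} [Fintype ι]

/-- The **Casimir operator** `C = ∑ₐ (X a)† ∘ (X a)` of a finite family of bounded operators (for a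
skew-adjoint family, `C = -∑ₐ (X a)²`: the quadratic Casimir `-∑ₐ ∂ₐ∂ₐ` of a unitary representation in an
orthonormal basis of the Lie algebra). [folklore] -/
noncomputable def casimir (X : ι → H →L[ℂ] H) : H →L[ℂ] H := ∑ a, adjoint (X a) ∘L X a

/-- `⟪v, C v⟫ = ∑ₐ ⟪X a v, X a v⟫`. [folklore] -/
theorem inner_casimir_self (X : ι → H →L[ℂ] H) (v : H) :
    ⟪v, casimir X v⟫_ℂ = ∑ a, ⟪X a v, X a v⟫_ℂ := by
  unfold casimir
  rw [_root_.sum_apply, inner_sum]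
  refine Finset.sum_congr rfl fun a _ => ?_
  rw [ContinuousLinearMap.comp_apply, adjoint_inner_right]

/-- `re ⟪v, C v⟫ = ∑ₐ ‖X a v‖²`. [folklore] -/
theorem re_inner_casimir_self (X : ι → H →L[ℂ] H) (v : H) :
    re ⟪v, casimir X v⟫_ℂ = ∑ a, ‖X a v‖ ^ 2 := by
  rw [inner_casimir_self, map_sum]
  refine Finset.sum_congr rfl fun a _ => ?_
  exact inner_self_eq_norm_sq _

/-- For a skew-adjoint family, `C = -∑ₐ (X a)²`. [folklore] -/
theorem casimir_eq_neg_sum_sq (X : ι → H →L[ℂ] H) (hX : ∀ a, adjoint (X a) = -X a) :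
    casimir X = -∑ a, X a ∘L X a := by
  unfold casimir
  rw [← Finset.sum_neg_distrib]
  refine Finset.sum_congr rfl fun a _ => ?_
  rw [hX a, ContinuousLinearMap.neg_comp]

/-- The Casimir operator is self-adjoint. [folklore] -/
theorem adjoint_casimir (X : ι → H →L[ℂ] H) : adjoint (casimir X) = casimir X := by
  unfold casimir
  rw [map_sum]
  refine Finset.sum_congr rfl fun a _ => ?_
  rw [adjoint_comp, adjoint_adjoint]

/-- **Derivative cost, quadratic form:** `‖X a v‖² ≤ re ⟪v, C v⟫` for every member of the family. [folklore] -/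
theorem norm_apply_sq_le (X : ι → H →L[ℂ] H) (a : ι) (v : H) :
    ‖X a v‖ ^ 2 ≤ re ⟪v, casimir X v⟫_ℂ := by
  rw [re_inner_casimir_self]
  exact Finset.single_le_sum (f := fun b => ‖X b v‖ ^ 2) (fun b _ => sq_nonneg _) (Finset.mem_univ a)

/-- On a `c`-eigenvector of `C`, `re ⟪v, C v⟫ = c ‖v‖²`. [folklore] -/
theorem re_inner_casimir_of_eigen (X : ι → H →L[ℂ] H) {v : H} {c : ℝ}
    (hv : casimir X v = (c : ℂ) • v) : re ⟪v, casimir X v⟫_ℂ = c * ‖v‖ ^ 2 := by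
  rw [hv, inner_smul_right, ← inner_self_eq_norm_sq (𝕜 := ℂ) v]
  simp only [RCLike.re_to_complex, Complex.re_ofReal_mul]

/-- **Casimir eigenvalues are nonnegative** (on a nonzero eigenvector). [folklore] -/
theorem eigen_nonneg (X : ι → H →L[ℂ] H) {v : H} {c : ℝ} (hv : casimir X v = (c : ℂ) • v)
    (hv0 : v ≠ 0) : 0 ≤ c := by
  have h1 : 0 ≤ re ⟪v, casimir X v⟫_ℂ := by
    rw [re_inner_casimir_self]; exact Finset.sum_nonneg fun a _ => sq_nonneg _
  rw [re_inner_casimir_of_eigen X hv] at h1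
  have h2 : 0 < ‖v‖ ^ 2 := by positivity
  nlinarith

/-- **Derivative cost on a mode:** `‖X a w‖ ≤ √c · ‖w‖` for `C w = c w` — a link derivative acting on a term
whose left vector has Casimir `c` at that link costs a factor `√c`, uniformly in the representation.
(THEORY-1 §19.2 (E2); Lüscher App. E uses the same inequality inside Peter–Weyl blocks.) [folklore] -/
theorem norm_apply_le_sqrt_mul_norm (X : ι → H →L[ℂ] H) (a : ι) {w : H} {c : ℝ}
    (hw : casimir X w = (c : ℂ) • w) : ‖X a w‖ ≤ Real.sqrt c * ‖w‖ := by
  have h1 : ‖X a w‖ ^ 2 ≤ c * ‖w‖ ^ 2 := (norm_apply_sq_le X a w).trans (re_inner_casimir_of_eigen X hw).le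
  by_cases hw0 : w = 0
  · subst hw0; simp
  have hc : 0 ≤ c := eigen_nonneg X hw hw0
  calc ‖X a w‖ = Real.sqrt (‖X a w‖ ^ 2) := (Real.sqrt_sq (norm_nonneg _)).symm
    _ ≤ Real.sqrt (c * ‖w‖ ^ 2) := Real.sqrt_le_sqrt h1
    _ = Real.sqrt c * ‖w‖ := by rw [Real.sqrt_mul hc, Real.sqrt_sq (norm_nonneg _)]

/-- An operator commuting with `C` preserves its eigenspaces (used for: `X^b_e` preserves the Casimir
eigenspaces of every link, so a differentiated term keeps its mode). [folklore] -/
theorem eigen_apply_of_commute (X : ι → H →L[ℂ] H) {T : H →L[ℂ] H}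
    (hT : T ∘L casimir X = casimir X ∘L T) {w : H} {c : ℝ} (hw : casimir X w = (c : ℂ) • w) :
    casimir X (T w) = (c : ℂ) • T w := by
  have h := congrArg (fun F : H →L[ℂ] H => F w) hT
  simp only [ContinuousLinearMap.comp_apply] at h
  rw [← h, hw, map_smul]
end Casimir

/-! ## §2. Eigenvalue perturbation and the tensor shift -/
section Shift
variable [CompleteSpace H] {ι : Type*} [Fintype ι]

omit [CompleteSpace H] in
/-- **Eigenvalue perturbation:** if `(c·1 + B) u = c'·u` with `u ≠ 0` then `|c' - c| ≤ ‖B‖`. [folklore] -/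
theorem abs_sub_le_opNorm_of_eigen {B : H →L[ℂ] H} {u : H} (hu : u ≠ 0) {c c' : ℝ}
    (h : (c : ℂ) • u + B u = (c' : ℂ) • u) : |c' - c| ≤ ‖B‖ := by
  have hB : B u = ((c' - c : ℝ) : ℂ) • u := by
    rw [Complex.ofReal_sub, sub_smul]
    exact eq_sub_of_add_eq' h
  have h1 : |c' - c| * ‖u‖ ≤ ‖B‖ * ‖u‖ := by
    calc |c' - c| * ‖u‖ = ‖B u‖ := by rw [hB, norm_smul, Complex.norm_real, Real.norm_eq_abs]
      _ ≤ ‖B‖ * ‖u‖ := B.le_opNorm u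
  exact le_of_mul_le_mul_right h1 (norm_pos_iff.2 hu)

/-- Expansion of the Casimir of a sum family: `C_{Y+Z} = C_Y + C_Z + ∑ₐ ((Y a)†(Z a) + (Z a)†(Y a))`.
[folklore] -/
theorem casimir_add (Y Z : ι → H →L[ℂ] H) :
    casimir (fun a => Y a + Z a) =
      casimir Y + casimir Z + ∑ a, (adjoint (Y a) ∘L Z a + adjoint (Z a) ∘L Y a) := by
  unfold casimir
  rw [← Finset.sum_add_distrib, ← Finset.sum_add_distrib]
  refine Finset.sum_congr rfl fun a _ => ?_
  rw [map_add, ContinuousLinearMap.add_comp, ContinuousLinearMap.comp_add, ContinuousLinearMap.comp_add]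
  abel

/-- **The tensor shift (abstract form of Lüscher's "adding a plaquette shifts the representation by a
bounded amount").** Let `X' a = Y a + Z a` where each `Z a` is skew-adjoint and commutes with `Y a`
(in the application: `Y a` = the generator `T_a` acting on the plaquette's slots at a link, `Z a` = the same
generator acting on the old slots; different slots commute).  If `u ≠ 0` is a `c`-eigenvector of `C_Z` and a
`c'`-eigenvector of `C_{X'}`, then `|c' - c| ≤ ‖C_Y‖ + 2 (∑ₐ ‖Y a‖) √c`.  No irreducibility, highest weight
or Clebsch–Gordan series is used. (THEORY-1 §19.2 (E4).) [ours] -/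
theorem eigen_shift (Y Z : ι → H →L[ℂ] H) (hZ : ∀ a, adjoint (Z a) = -Z a)
    (hYZ : ∀ a, Y a ∘L Z a = Z a ∘L Y a) {u : H} (hu : u ≠ 0) {c c' : ℝ}
    (huZ : casimir Z u = (c : ℂ) • u) (hu' : casimir (fun a => Y a + Z a) u = (c' : ℂ) • u) :
    |c' - c| ≤ ‖casimir Y‖ + 2 * (∑ a, ‖Y a‖) * Real.sqrt c := by
  -- `(C' - c) u = C_Y u + ∑ₐ (Y a)†(Z a u) - ∑ₐ Z a (Y a u)` and each cross term is `≤ ‖Y a‖ √c ‖u‖`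
  have hc : 0 ≤ c := eigen_nonneg Z huZ hu
  set R : H →L[ℂ] H := casimir Y + ∑ a, (adjoint (Y a) ∘L Z a + adjoint (Z a) ∘L Y a) with hR
  have hdecomp : (c : ℂ) • u + R u = (c' : ℂ) • u := by
    rw [← hu', casimir_add, ← huZ]
    simp only [hR, add_apply]
    abel
  -- bound `‖R u‖` directly (sharper than `‖R‖`): `‖R u‖ ≤ (‖C_Y‖ + 2 τ √c) ‖u‖`
  have hRu : ‖R u‖ ≤ (‖casimir Y‖ + 2 * (∑ a, ‖Y a‖) * Real.sqrt c) * ‖u‖ := by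
    have hcross : ∀ a, ‖(adjoint (Y a) ∘L Z a + adjoint (Z a) ∘L Y a) u‖ ≤
        2 * ‖Y a‖ * Real.sqrt c * ‖u‖ := by
      intro a
      have h1 : ‖adjoint (Y a) (Z a u)‖ ≤ ‖Y a‖ * (Real.sqrt c * ‖u‖) := by
        calc ‖adjoint (Y a) (Z a u)‖ ≤ ‖adjoint (Y a)‖ * ‖Z a u‖ := le_opNorm _ _
          _ = ‖Y a‖ * ‖Z a u‖ := by rw [adjoint.norm_map]
          _ ≤ ‖Y a‖ * (Real.sqrt c * ‖u‖) :=
            mul_le_mul_of_nonneg_left (norm_apply_le_sqrt_mul_norm Z a huZ) (norm_nonneg _)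
      have h2 : ‖adjoint (Z a) (Y a u)‖ ≤ ‖Y a‖ * (Real.sqrt c * ‖u‖) := by
        have hcomm : Z a (Y a u) = Y a (Z a u) := by
          have := congrArg (fun F : H →L[ℂ] H => F u) (hYZ a)
          simpa only [ContinuousLinearMap.comp_apply] using this.symm
        calc ‖adjoint (Z a) (Y a u)‖ = ‖Z a (Y a u)‖ := by
              rw [hZ a, neg_apply, norm_neg]
          _ = ‖Y a (Z a u)‖ := by rw [hcomm]
          _ ≤ ‖Y a‖ * ‖Z a u‖ := le_opNorm _ _
          _ ≤ ‖Y a‖ * (Real.sqrt c * ‖u‖) :=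
            mul_le_mul_of_nonneg_left (norm_apply_le_sqrt_mul_norm Z a huZ) (norm_nonneg _)
      calc ‖(adjoint (Y a) ∘L Z a + adjoint (Z a) ∘L Y a) u‖
          = ‖adjoint (Y a) (Z a u) + adjoint (Z a) (Y a u)‖ := by
            simp only [add_apply, ContinuousLinearMap.comp_apply]
        _ ≤ ‖adjoint (Y a) (Z a u)‖ + ‖adjoint (Z a) (Y a u)‖ := norm_add_le _ _
        _ ≤ 2 * ‖Y a‖ * Real.sqrt c * ‖u‖ := by nlinarith [h1, h2]
    calc ‖R u‖ = ‖casimir Y u + (∑ a, (adjoint (Y a) ∘L Z a + adjoint (Z a) ∘L Y a)) u‖ := by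
          simp only [hR, add_apply]
      _ ≤ ‖casimir Y u‖ + ‖(∑ a, (adjoint (Y a) ∘L Z a + adjoint (Z a) ∘L Y a)) u‖ := norm_add_le _ _
      _ ≤ ‖casimir Y‖ * ‖u‖ + ∑ a, 2 * ‖Y a‖ * Real.sqrt c * ‖u‖ := by
          refine add_le_add (le_opNorm _ _) ?_
          rw [_root_.sum_apply]
          exact (norm_sum_le _ _).trans (Finset.sum_le_sum fun a _ => hcross a)
      _ = (‖casimir Y‖ + 2 * (∑ a, ‖Y a‖) * Real.sqrt c) * ‖u‖ := by
          rw [← Finset.sum_mul, ← Finset.sum_mul, ← Finset.mul_sum]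
          ring
  -- conclude as in `abs_sub_le_opNorm_of_eigen`, with `‖R u‖` in place of `‖R‖ ‖u‖`
  have hB : R u = ((c' - c : ℝ) : ℂ) • u := by
    rw [Complex.ofReal_sub, sub_smul]
    exact eq_sub_of_add_eq' hdecomp
  have h1 : |c' - c| * ‖u‖ ≤ (‖casimir Y‖ + 2 * (∑ a, ‖Y a‖) * Real.sqrt c) * ‖u‖ := by
    calc |c' - c| * ‖u‖ = ‖R u‖ := by rw [hB, norm_smul, Complex.norm_real, Real.norm_eq_abs]
      _ ≤ _ := hRu
  exact le_of_mul_le_mul_right h1 (norm_pos_iff.2 hu)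
end Shift

/-! ## §3. The weight shift -/
section WeightShift
/-- The **shift constant** `σ(τ, c̄) = τ + √(τ² + c̄)`. [ours] -/
noncomputable def shiftConst (τ cb : ℝ) : ℝ := τ + Real.sqrt (τ ^ 2 + cb)

/-- `σ ≥ 0` for `τ ≥ 0`. [ours] -/
theorem shiftConst_nonneg {τ cb : ℝ} (hτ : 0 ≤ τ) : 0 ≤ shiftConst τ cb :=
  add_nonneg hτ (Real.sqrt_nonneg _)

/-- **Two-sided weight shift.** If `|c' - c| ≤ c̄ + 2τ√c` with `c, τ, c̄ ≥ 0` then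
`√c' ≤ √c + σ` and `√c ≤ √c' + σ`, `σ = τ + √(τ² + c̄)`: the link weight `√c_e` of a term moves by at
most `σ` when a plaquette is multiplied in (THEORY-1 §19.2 (E5); feeds `local_on` / `tw_le` of
`IsTransferStep`). [ours] -/
theorem sqrt_shift {c c' τ cb : ℝ} (hc : 0 ≤ c) (hτ : 0 ≤ τ) (hcb : 0 ≤ cb)
    (h : |c' - c| ≤ cb + 2 * τ * Real.sqrt c) :
    Real.sqrt c' ≤ Real.sqrt c + shiftConst τ cb ∧ Real.sqrt c ≤ Real.sqrt c' + shiftConst τ cb := by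
  set r := Real.sqrt (τ ^ 2 + cb) with hr
  have hr0 : 0 ≤ r := Real.sqrt_nonneg _
  have hr2 : r ^ 2 = τ ^ 2 + cb := Real.sq_sqrt (by positivity)
  have hσ : shiftConst τ cb = τ + r := rfl
  set s := Real.sqrt c with hs
  have hs0 : 0 ≤ s := Real.sqrt_nonneg _
  have hs2 : s ^ 2 = c := Real.sq_sqrt hc
  have hup : c' ≤ c + cb + 2 * τ * s := by have := (abs_le.1 h).2; linarith
  have hlo : c - cb - 2 * τ * s ≤ c' := by have := (abs_le.1 h).1; linarith
  constructor
  · -- `c' ≤ (s + σ)²`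
    have hsq : c' ≤ (s + (τ + r)) ^ 2 := by nlinarith [hr2, hs2, sq_nonneg τ]
    calc Real.sqrt c' ≤ Real.sqrt ((s + (τ + r)) ^ 2) := Real.sqrt_le_sqrt hsq
      _ = s + (τ + r) := Real.sqrt_sq (by positivity)
      _ = Real.sqrt c + shiftConst τ cb := by rw [hσ]
  · rw [hσ]
    by_cases hcase : s ≤ τ + r
    · linarith [Real.sqrt_nonneg c']
    · push Not at hcase
      -- `(s - σ)² ≤ c'`, using `r s ≥ r σ`
      have hkey : (s - (τ + r)) ^ 2 ≤ c' := by
        have h3 : r * (τ + r) ≤ r * s := mul_le_mul_of_nonneg_left hcase.le hr0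
        nlinarith [hr2, hs2, h3]
      have h4 : s - (τ + r) ≤ Real.sqrt c' := by
        calc s - (τ + r) = Real.sqrt ((s - (τ + r)) ^ 2) := (Real.sqrt_sq (by linarith)).symm
          _ ≤ Real.sqrt c' := Real.sqrt_le_sqrt hkey
      linarith
end WeightShift

/-! ## §4. Gradings and re-grading -/
section Grading
variable [CompleteSpace H] {π : Type*} [Fintype π]

/-- A **grading** of `H`: a finite family of self-adjoint idempotents, pairwise orthogonal, summing to the
identity (in the application: the orthogonal projections onto the joint eigenspaces of the commuting
per-link Casimir operators). [folklore] -/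
structure IsGrading (P : π → H →L[ℂ] H) : Prop where
  sum_eq : ∑ i, P i = 1
  idem : ∀ i, P i ∘L P i = P i
  selfAdjoint : ∀ i, adjoint (P i) = P i
  orth : ∀ i j, i ≠ j → P i ∘L P j = 0

namespace IsGrading

variable {P : π → H →L[ℂ] H}

/-- `∑ᵢ Pᵢ v = v`. [folklore] -/
theorem sum_apply_eq (hP : IsGrading P) (v : H) : ∑ i, P i v = v := by
  have h := congrArg (fun F : H →L[ℂ] H => F v) hP.sum_eq
  simpa only [_root_.sum_apply, one_apply_eq_self] using h

/-- `⟪Pᵢ v, Pⱼ w⟫ = 0` for `i ≠ j`. [folklore] -/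
theorem inner_apply_apply_of_ne (hP : IsGrading P) {i j : π} (hij : i ≠ j) (v w : H) :
    ⟪P i v, P j w⟫_ℂ = 0 := by
  rw [← adjoint_inner_right, hP.selfAdjoint, ← ContinuousLinearMap.comp_apply, hP.orth i j hij,
    _root_.zero_apply, inner_zero_right]

/-- `⟪Pᵢ v, Pᵢ w⟫ = ⟪Pᵢ v, w⟫`. [folklore] -/
theorem inner_apply_apply_self (hP : IsGrading P) (i : π) (v w : H) :
    ⟪P i v, P i w⟫_ℂ = ⟪P i v, w⟫_ℂ := by
  rw [← adjoint_inner_left, hP.selfAdjoint, ← ContinuousLinearMap.comp_apply, hP.idem]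

/-- **Pythagoras for a grading:** `∑ᵢ ‖Pᵢ v‖² = ‖v‖²`. [folklore] -/
theorem sum_norm_sq (hP : IsGrading P) (v : H) : ∑ i, ‖P i v‖ ^ 2 = ‖v‖ ^ 2 := by
  have h : ⟪v, v⟫_ℂ = ∑ i, ⟪P i v, P i v⟫_ℂ := by
    conv_lhs => rw [← hP.sum_apply_eq v]
    rw [sum_inner]
    refine Finset.sum_congr rfl fun i _ => ?_
    rw [inner_sum]
    exact Finset.sum_eq_single i (fun j _ hji => hP.inner_apply_apply_of_ne (Ne.symm hji) v v) (by simp)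
  have h2 := congrArg re h
  rw [map_sum] at h2
  simp only [inner_self_eq_norm_sq] at h2
  exact h2.symm

/-- **The re-grading inequality:** `∑ᵢ ‖Pᵢ v‖ · ‖Pᵢ w‖ ≤ ‖v‖ · ‖w‖` — re-grading BOTH vectors of a rank-one
term after a multiplication costs nothing in mass, however many joint eigenspaces appear (Cauchy–Schwarz over
the grading plus Pythagoras).  This is the step where every cruder norm (sup per component, `L²` per
component, coefficient `ℓ¹`) loses a mode-count factor (THEORY-1 §18.5, §19.2 (E3)). [ours] -/
theorem sum_norm_mul_norm_le (hP : IsGrading P) (v w : H) :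
    ∑ i, ‖P i v‖ * ‖P i w‖ ≤ ‖v‖ * ‖w‖ := by
  have hcs := Finset.sum_mul_sq_le_sq_mul_sq Finset.univ (fun i => ‖P i v‖) (fun i => ‖P i w‖)
  rw [hP.sum_norm_sq v, hP.sum_norm_sq w] at hcs
  have h0 : 0 ≤ ∑ i, ‖P i v‖ * ‖P i w‖ := Finset.sum_nonneg fun i _ => by positivity
  have h1 : (∑ i, ‖P i v‖ * ‖P i w‖) ^ 2 ≤ (‖v‖ * ‖w‖) ^ 2 := by rw [mul_pow]; exact hcs
  exact (sq_le_sq₀ h0 (by positivity)).1 h1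

/-- **Splitting a matrix coefficient along the grading:** if `R` commutes with every `Pᵢ` then
`⟪R v, w⟫ = ∑ᵢ ⟪R (Pᵢ v), Pᵢ w⟫` (in the application `R = ρ(U)` for `U` in the gauge group, which commutes
with the Casimir operators, hence with their joint spectral projections). [folklore] -/
theorem inner_eq_sum (hP : IsGrading P) {R : H →L[ℂ] H} (hR : ∀ i, R ∘L P i = P i ∘L R) (v w : H) :
    ⟪R v, w⟫_ℂ = ∑ i, ⟪R (P i v), P i w⟫_ℂ := by
  conv_lhs => rw [← hP.sum_apply_eq v, map_sum, sum_inner]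
  refine Finset.sum_congr rfl fun i _ => ?_
  have h1 : R (P i v) = P i (R (P i v)) := by
    have := congrArg (fun F : H →L[ℂ] H => F (P i v)) (hR i)
    simp only [ContinuousLinearMap.comp_apply] at this
    rw [← this, ← ContinuousLinearMap.comp_apply (P i) (P i), hP.idem]
  rw [h1, ← adjoint_inner_right, hP.selfAdjoint, ← h1]

/-- The masses after splitting: `∑ᵢ ‖Pᵢ v‖ ‖Pᵢ w‖ ≤ ‖v‖ ‖w‖` restated for the summands of `inner_eq_sum`
with a bounded `R`: `∑ᵢ ‖⟪R (Pᵢ v), Pᵢ w⟫‖ ≤ ‖R‖ ‖v‖ ‖w‖`. [ours] -/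
theorem sum_norm_inner_le (hP : IsGrading P) (R : H →L[ℂ] H) (v w : H) :
    ∑ i, ‖⟪R (P i v), P i w⟫_ℂ‖ ≤ ‖R‖ * (‖v‖ * ‖w‖) := by
  calc ∑ i, ‖⟪R (P i v), P i w⟫_ℂ‖ ≤ ∑ i, ‖R‖ * (‖P i v‖ * ‖P i w‖) := by
        refine Finset.sum_le_sum fun i _ => ?_
        calc ‖⟪R (P i v), P i w⟫_ℂ‖ ≤ ‖R (P i v)‖ * ‖P i w‖ := norm_inner_le_norm _ _
          _ ≤ ‖R‖ * ‖P i v‖ * ‖P i w‖ := mul_le_mul_of_nonneg_right (R.le_opNorm _) (norm_nonneg _)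
          _ = ‖R‖ * (‖P i v‖ * ‖P i w‖) := by ring
    _ = ‖R‖ * ∑ i, ‖P i v‖ * ‖P i w‖ := by rw [Finset.mul_sum]
    _ ≤ ‖R‖ * (‖v‖ * ‖w‖) := mul_le_mul_of_nonneg_left (hP.sum_norm_mul_norm_le v w) (norm_nonneg _)
end IsGrading

/-- **Orthogonal projections onto an internal orthogonal decomposition form a grading** — the bridge from
Mathlib's joint-eigenspace decomposition (`LinearMap.IsSymmetric.directSum_isInternal_of_pairwise_commute`,
restricted to a finite index set) to `IsGrading`: a finite pairwise-orthogonal family of complete subspaces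
whose supremum is `⊤` yields the grading `Pᵢ = (V i).starProjection`. [folklore] -/
theorem isGrading_starProjection (V : π → Submodule ℂ H) [∀ i, CompleteSpace (V i)]
    (hV : OrthogonalFamily ℂ (fun i => V i) fun i => (V i).subtypeₗᵢ) (htop : iSup V = ⊤) :
    IsGrading (fun i => (V i).starProjection) where
  sum_eq := by
    ext v
    rw [_root_.sum_apply, one_apply_eq_self]
    exact hV.sum_projection_of_mem_iSup v (htop ▸ Submodule.mem_top)
  idem i := by
    have h := (V i).isIdempotentElem_starProjection
    rwa [IsIdempotentElem, ContinuousLinearMap.mul_def] at h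
  selfAdjoint i := ContinuousLinearMap.isSelfAdjoint_iff'.1 (isSelfAdjoint_starProjection (V i))
  orth i j hij := (hV.isOrtho hij).starProjection_comp_starProjection
end Grading

/-! ## §5. The matrix-coefficient (domination) bound -/
section Coefficient
variable [CompleteSpace H] {ι : Type*} [Fintype ι]

/-- **Domination of one term:** for a contraction `R` (`‖R‖ ≤ 1`; in the application `R = ρ(U)`, unitary)
and a left vector `w` with Casimir `c` at the differentiated link, the link derivative of the matrix
coefficient `U ↦ ⟪ρ(U) v, w⟫` in the direction `a`, which is `-⟪ρ(U) v, X a w⟫` for skew-adjoint `X a`, is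
bounded by `‖v‖ · √c · ‖w‖` = (mass) × (link weight).  Summed over the terms of `S̃^{(k)}` this is the field
`dominates` of `LocalModeNormData` (THEORY-1 §19.3). [ours] -/
theorem norm_inner_apply_le (X : ι → H →L[ℂ] H) (a : ι) {R : H →L[ℂ] H} (hR : ‖R‖ ≤ 1) (v : H)
    {w : H} {c : ℝ} (hw : casimir X w = (c : ℂ) • w) :
    ‖⟪R v, X a w⟫_ℂ‖ ≤ ‖v‖ * (Real.sqrt c * ‖w‖) := by
  calc ‖⟪R v, X a w⟫_ℂ‖ ≤ ‖R v‖ * ‖X a w‖ := norm_inner_le_norm _ _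
    _ ≤ ‖v‖ * (Real.sqrt c * ‖w‖) := by
        refine mul_le_mul ?_ (norm_apply_le_sqrt_mul_norm X a hw) (norm_nonneg _) (norm_nonneg _)
        calc ‖R v‖ ≤ ‖R‖ * ‖v‖ := R.le_opNorm v
          _ ≤ 1 * ‖v‖ := mul_le_mul_of_nonneg_right hR (norm_nonneg _)
          _ = ‖v‖ := one_mul _

/-- **Laplacian of one term:** if `C w = c w` then `⟪R v, C w⟫ = c ⟪R v, w⟫` — a matrix coefficient with
graded left vector is an eigenfunction of the link Laplacian with eigenvalue `∑_e c_e`, so `Δ⁻¹` acts on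
graded data as division by the total Casimir (THEORY-1 §19.3, the "÷ c(π)" step). [folklore] -/
theorem inner_apply_casimir_eq (X : ι → H →L[ℂ] H) (R : H →L[ℂ] H) (v : H) {w : H} {c : ℝ}
    (hw : casimir X w = (c : ℂ) • w) : ⟪R v, casimir X w⟫_ℂ = (c : ℂ) * ⟪R v, w⟫_ℂ := by
  rw [hw, inner_smul_right]

/-- **Zero modes carry no gradient:** if `C w = 0` then `X a w = 0` for every `a` (so a term graded in the
joint eigenvalue `0` at every link has all link derivatives zero, hence is constant on the connected gauge
group by the tree's `ZeroModes.lean`; such terms are the constants `Ċ^{(k)}` of the recursion). [folklore] -/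
theorem apply_eq_zero_of_casimir_eq_zero (X : ι → H →L[ℂ] H) (a : ι) {w : H} (hw : casimir X w = 0) :
    X a w = 0 := by
  have h := norm_apply_le_sqrt_mul_norm X a (c := 0) (by rw [hw]; simp)
  rw [Real.sqrt_zero, zero_mul] at h
  exact norm_le_zero_iff.1 h
end Coefficient
end Summit.Ventures.LatticeQCDFlow.TrivializingMaps.CasimirGrading
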